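import Mathlib
import Literature.NumberTheory.Automorphic.HilbertModularFormQExpansion
import Summits.Langlands.Langlands.Theorems.CapacityClassicalityHilbertIntegralOverconvergentIsCongruenceKoecherGlue
import Summits.Langlands.Langlands.Theorems.CapacityClassicalityHilbertIntegralOverconvergentIsCongruenceFourierKoecher
import Summits.Langlands.Langlands.Theorems.CapacityClassicalityHilbertIntegralOverconvergentIsCongruenceStubFourierCoeffAtOfHasSum
import Summits.Langlands.Langlands.Theorems.CapacityClassicalityHilbertIntegralOverconvergentIsCongruenceStubBoundedOfCoeffSupport

/-!
# Multiplicativity of Hilbert `q`-expansions on the cone (stub O2)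

Stub O2 `stub_fourierCoeff_mul` of line Sketch-ideate-r1-k1 (section O, RESHAPE 11) for the crux
`HilbertIntegralOverconvergentIsCongruence` (stmt-Langlands-8485): for holomorphic `𝓞 F`-periodic `f`, `g` on the tube domain whose
Fourier coefficients vanish off the cone `qIndexSet F` (`0` or totally positive indices of the dual lattice — as for modular forms,
by Koecher), `a_ν(fg) = ∑_{μ + μ' = ν} a_μ(f) a_{μ'}(g)` over pairs of cone indices.  Proof: the Fourier expansions of `f` and `g`
(`hasSum_fourierCoeff`, Freitag I.4.1) converge absolutely, so their Cauchy product converges to `fg` (`HasSum.mul`); regrouping the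
pairs `(μ, μ')` of dual-lattice indices by `μ + μ'` (`HasSum.sigma`, `summable_partition`) exhibits `fg` on every height-`1` slice as a
`q`-series with coefficients `c_ν = ∑'_{μ+μ'=ν} a_μ b_{μ'}`, absolutely dominated; by uniqueness of coefficients
(`stub_fourierCoeffAt_of_hasSum`) `a_ν(fg) = c_ν`, and the cone condition reduces the fibre sum to the finite set `T`.
-/

set_option linter.dupNamespace false

noncomputable section

namespace Summit.Langlands.Langlands.Theorems.HilbertIntegralOverconvergentIsCongruence

open MeasureTheory Complex NumberField
open Literature.NumberTheory.Automorphic Literature.NumberTheory.Automorphic.HilbertModular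

variable {F : Type} [Field F] [NumberField F]

/-- The dual lattice is closed under addition. -/
theorem fcm_dual_add {μ μ' : F} (hμ : ∀ a : 𝓞 F, ∃ n : ℤ, Algebra.trace ℚ F (μ * a) = n)
    (hμ' : ∀ a : 𝓞 F, ∃ n : ℤ, Algebra.trace ℚ F (μ' * a) = n) :
    ∀ a : 𝓞 F, ∃ n : ℤ, Algebra.trace ℚ F ((μ + μ') * a) = n := by
  intro a
  obtain ⟨n, hn⟩ := hμ a
  obtain ⟨n', hn'⟩ := hμ' a
  exact ⟨n + n', by rw [add_mul, map_add, hn, hn']; push_cast; ring⟩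

/-- The dual lattice is closed under subtraction. -/
theorem fcm_dual_sub {μ μ' : F} (hμ : ∀ a : 𝓞 F, ∃ n : ℤ, Algebra.trace ℚ F (μ * a) = n)
    (hμ' : ∀ a : 𝓞 F, ∃ n : ℤ, Algebra.trace ℚ F (μ' * a) = n) :
    ∀ a : 𝓞 F, ∃ n : ℤ, Algebra.trace ℚ F ((μ - μ') * a) = n := by
  intro a
  obtain ⟨n, hn⟩ := hμ a
  obtain ⟨n', hn'⟩ := hμ' a
  exact ⟨n - n', by rw [sub_mul, map_sub, hn, hn']; push_cast; ring⟩

/-- The phase of a `q`-monomial is multiplicative in the index: `e^{2πi S((μ+μ')z)} = e^{2πi S(μz)} e^{2πi S(μ'z)}`. -/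
theorem fcm_cexp_pairing_add (μ μ' : F) (z : Point F) :
    cexp (2 * Real.pi * I * pairing (μ + μ') z) =
      cexp (2 * Real.pi * I * pairing μ z) * cexp (2 * Real.pi * I * pairing μ' z) := by
  rw [← Complex.exp_add]
  congr 1
  simp only [pairing, map_add, Complex.ofReal_add, add_mul, Finset.sum_add_distrib]
  ring

/-- **Stub O2 — `stub_fourierCoeff_mul`.** Multiplicativity of `q`-expansions: for holomorphic `𝓞 F`-periodic `f`, `g` on `ℍ`
whose Fourier coefficients vanish off the cone `qIndexSet F`, the Fourier coefficients of `f·g` are the finite convolution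
`a_ν(fg) = ∑_{μ + μ' = ν} a_μ(f) a_{μ'}(g)` over pairs of cone indices. [cite: Freitag1990, Ch. I §4] -/
theorem stub_fourierCoeff_mul (F : Type) [Field F] [NumberField F] [NumberField.IsTotallyReal F] (f g : Point F → ℂ)
    (hf : IsHolomorphicOn F f) (hg : IsHolomorphicOn F g)
    (hperf : ∀ (a : 𝓞 F) (z : Point F), z ∈ halfSpace F → f (fun σ ↦ z σ + ((σ (a : F) : ℝ) : ℂ)) = f z)
    (hperg : ∀ (a : 𝓞 F) (z : Point F), z ∈ halfSpace F → g (fun σ ↦ z σ + ((σ (a : F) : ℝ) : ℂ)) = g z)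
    (hsf : ∀ μ : F, (∀ a : 𝓞 F, ∃ n : ℤ, Algebra.trace ℚ F (μ * a) = n) → μ ∉ qIndexSet F → fourierCoeff f μ = 0)
    (hsg : ∀ μ : F, (∀ a : 𝓞 F, ∃ n : ℤ, Algebra.trace ℚ F (μ * a) = n) → μ ∉ qIndexSet F → fourierCoeff g μ = 0)
    (ν : F) (hν : ∀ a : 𝓞 F, ∃ n : ℤ, Algebra.trace ℚ F (ν * a) = n) (T : Finset (F × F))
    (hT : ∀ μ : F × F, μ ∈ T ↔ μ.1 ∈ qIndexSet F ∧ μ.2 ∈ qIndexSet F ∧ μ.1 + μ.2 = ν) :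
    fourierCoeff (f * g) ν = ∑ μ ∈ T, fourierCoeff f μ.1 * fourierCoeff g μ.2 := by
  classical
  -- the dual lattice as a type, its sum map and fibres
  set D : Set F := {ν : F | ∀ a : 𝓞 F, ∃ n : ℤ, Algebra.trace ℚ F (ν * a) = n} with hDdef
  let add : D × D → D := fun p ↦ ⟨(p.1 : F) + p.2, fcm_dual_add p.1.2 p.2.2⟩
  let Fib : D → Type := fun ν' ↦ {p : D × D // add p = ν'}
  set a : F → ℂ := fourierCoeff f with hadef
  set b : F → ℂ := fourierCoeff g with hbdef
  -- the convolution coefficients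
  let c : F → ℂ := fun ν' ↦ if h : ν' ∈ D then ∑' p : Fib ⟨ν', h⟩, a p.1.1 * b p.1.2 else 0
  -- heights: everything happens at height `1`
  set y₁ : (F →+* ℝ) → ℝ := fun _ ↦ 1 with hy₁def
  have hy₁ : ∀ σ, 0 < y₁ σ := fun _ ↦ one_pos
  set w : D → ℝ := fun μ ↦ Real.exp (-(2 * Real.pi * ∑ σ : F →+* ℝ, σ (μ : F) * y₁ σ)) with hwdef
  have hw_pos : ∀ μ, 0 < w μ := fun μ ↦ Real.exp_pos _
  have hw_add : ∀ p : D × D, w (add p) = w p.1 * w p.2 := by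
    intro p
    simp only [hwdef, ← Real.exp_add]
    congr 1
    simp only [add, map_add, add_mul, Finset.sum_add_distrib]
    ring
  -- absolute summability of the two expansions at height `1`
  have hz₁ : cubePoint (0 : Coord F) y₁ ∈ halfSpace F := koe_cubePoint_mem_halfSpace 0 hy₁
  have habsf : Summable fun μ : D ↦ ‖a μ‖ * w μ := by
    have h := (hasSum_fourierCoeff F f hf hperf _ hz₁).2
    refine h.congr fun μ ↦ ?_
    simp [hwdef, hadef, koe_cubePoint_im]
  have habsg : Summable fun μ : D ↦ ‖b μ‖ * w μ := by
    have h := (hasSum_fourierCoeff F g hg hperg _ hz₁).2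
    refine h.congr fun μ ↦ ?_
    simp [hwdef, hbdef, koe_cubePoint_im]
  -- the product family of weights is summable, and so is its regrouping by the sum map
  have hprodw : Summable fun p : D × D ↦ (‖a p.1‖ * w p.1) * (‖b p.2‖ * w p.2) :=
    habsf.mul_of_nonneg habsg (fun μ ↦ mul_nonneg (norm_nonneg _) (hw_pos μ).le)
      (fun μ ↦ mul_nonneg (norm_nonneg _) (hw_pos μ).le)
  have hpart : ∀ p : D × D, ∃! ν' : D, p ∈ {q : D × D | add q = ν'} := fun p ↦
    ⟨add p, rfl, fun ν' h ↦ h.symm⟩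
  have hnonneg : (0 : D × D → ℝ) ≤ fun p ↦ (‖a p.1‖ * w p.1) * (‖b p.2‖ * w p.2) := fun p ↦
    mul_nonneg (mul_nonneg (norm_nonneg _) (hw_pos _).le) (mul_nonneg (norm_nonneg _) (hw_pos _).le)
  obtain ⟨hfib, hout⟩ := (summable_partition hnonneg hpart).1 hprodw
  -- the fibre coefficient sums converge absolutely; `‖c ν'‖ w ν' ≤ ∑'_{fibre} ‖a‖w ‖b‖w`
  have hfib' : ∀ ν' : D, Summable fun p : Fib ν' ↦ ‖a p.1.1 * b p.1.2‖ := by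
    intro ν'
    have h := (hfib ν').mul_right (w ν')⁻¹
    refine (h.congr fun p ↦ ?_)
    have hp : add p.1 = ν' := p.2
    have hwν : w ν' = w (p : D × D).1 * w (p : D × D).2 := by
      have h' := hw_add p.1
      rwa [hp] at h'
    rw [norm_mul, hwν]
    field_simp [(hw_pos (p : D × D).1).ne', (hw_pos (p : D × D).2).ne']
  have hc_def : ∀ ν' : D, c ν' = ∑' p : Fib ν', a p.1.1 * b p.1.2 := by
    intro ν'
    simp only [c, dif_pos ν'.2]
  have hc_bound : ∀ ν' : D, ‖c ν'‖ * w ν' ≤ ∑' p : {q : D × D | add q = ν'},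
      (‖a (p : D × D).1‖ * w (p : D × D).1) * (‖b (p : D × D).2‖ * w (p : D × D).2) := by
    intro ν'
    rw [hc_def ν']
    have h1 : ‖∑' p : Fib ν', a p.1.1 * b p.1.2‖ ≤ ∑' p : Fib ν', ‖a p.1.1 * b p.1.2‖ := norm_tsum_le_tsum_norm (hfib' ν')
    have h2 : (∑' p : Fib ν', ‖a p.1.1 * b p.1.2‖) * w ν' =
        ∑' p : Fib ν', (‖a p.1.1‖ * w p.1.1) * (‖b p.1.2‖ * w p.1.2) := by
      rw [← tsum_mul_right]
      refine tsum_congr fun p ↦ ?_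
      have hp : add p.1 = ν' := p.2
      have hwν : w ν' = w p.1.1 * w p.1.2 := by
        have h' := hw_add p.1
        rwa [hp] at h'
      rw [norm_mul, hwν]
      ring
    calc ‖∑' p : Fib ν', a p.1.1 * b p.1.2‖ * w ν'
        ≤ (∑' p : Fib ν', ‖a p.1.1 * b p.1.2‖) * w ν' := mul_le_mul_of_nonneg_right h1 (hw_pos ν').le
      _ = ∑' p : Fib ν', (‖a p.1.1‖ * w p.1.1) * (‖b p.1.2‖ * w p.1.2) := h2
      _ = _ := rfl
  have habsc : Summable fun ν' : D ↦ ‖c ν'‖ * w ν' :=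
    Summable.of_nonneg_of_le (fun ν' ↦ mul_nonneg (norm_nonneg _) (hw_pos ν').le) hc_bound hout
  -- the product expansion at each point of the height-`1` slice, regrouped by the sum map
  have hsumc : ∀ x : Coord F, HasSum (fun ν' : D ↦ c ν' * cexp (2 * Real.pi * I * pairing (ν' : F) (cubePoint x y₁)))
      ((f * g) (cubePoint x y₁)) := by
    intro x
    set z := cubePoint x y₁ with hzdef
    have hz : z ∈ halfSpace F := koe_cubePoint_mem_halfSpace x hy₁
    have hF := (hasSum_fourierCoeff F f hf hperf z hz).1
    have hG := (hasSum_fourierCoeff F g hg hperg z hz).1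
    -- norms of the terms at height `1`
    have hnf : ∀ μ : D, ‖a μ * cexp (2 * Real.pi * I * pairing (μ : F) z)‖ = ‖a μ‖ * w μ := by
      intro μ; rw [bcs_norm_term]; simp [hwdef, hzdef, koe_cubePoint_im]
    have hng : ∀ μ : D, ‖b μ * cexp (2 * Real.pi * I * pairing (μ : F) z)‖ = ‖b μ‖ * w μ := by
      intro μ; rw [bcs_norm_term]; simp [hwdef, hzdef, koe_cubePoint_im]
    have hprod_summable : Summable fun p : D × D ↦
        (a p.1 * cexp (2 * Real.pi * I * pairing (p.1 : F) z)) * (b p.2 * cexp (2 * Real.pi * I * pairing (p.2 : F) z)) := by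
      refine Summable.of_norm (hprodw.congr fun p ↦ ?_)
      rw [norm_mul, hnf, hng]
    have hprod := hF.mul hG hprod_summable
    -- pass to the sigma type of fibres
    have hsig := ((Equiv.sigmaFiberEquiv add).hasSum_iff).2 hprod
    refine HasSum.sigma hsig fun ν' ↦ ?_
    -- the fibre over `ν'`
    have hterm : ∀ p : Fib ν',
        ((fun q : D × D ↦ (a q.1 * cexp (2 * Real.pi * I * pairing (q.1 : F) z)) *
            (b q.2 * cexp (2 * Real.pi * I * pairing (q.2 : F) z))) ∘ (Equiv.sigmaFiberEquiv add)) ⟨ν', p⟩ =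
          (a p.1.1 * b p.1.2) * cexp (2 * Real.pi * I * pairing (ν' : F) z) := by
      intro p
      have hp : add p.1 = ν' := p.2
      have hν' : ((ν' : D) : F) = (p.1.1 : F) + p.1.2 := by
        have h' := congrArg Subtype.val hp
        exact h'.symm
      show a p.1.1 * cexp (2 * Real.pi * I * pairing (p.1.1 : F) z) *
          (b p.1.2 * cexp (2 * Real.pi * I * pairing (p.1.2 : F) z)) =
        a p.1.1 * b p.1.2 * cexp (2 * Real.pi * I * pairing ((ν' : D) : F) z)
      rw [hν', fcm_cexp_pairing_add]
      ring
    have hgoal : HasSum (fun p : Fib ν' ↦ (a p.1.1 * b p.1.2) * cexp (2 * Real.pi * I * pairing ((ν' : D) : F) z))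
        (c ν' * cexp (2 * Real.pi * I * pairing ((ν' : D) : F) z)) := by
      rw [hc_def ν']
      exact ((hfib' ν').of_norm.hasSum).mul_right _
    exact hgoal.congr_fun hterm
  -- uniqueness of coefficients
  have hcoef : fourierCoeffAt (f * g) ν y₁ = c ν := stub_fourierCoeffAt_of_hasSum F (f * g) c y₁ hsumc habsc ν hν
  rw [fourierCoeff_eq, show (fun _ : F →+* ℝ ↦ (1 : ℝ)) = y₁ from rfl, hcoef, hc_def ⟨ν, hν⟩]
  -- the fibre sum over `ν` is the finite sum over `T`
  have hmemD : ∀ μ : F × F, μ ∈ T → μ.1 ∈ D ∧ μ.2 ∈ D := fun μ hμ ↦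
    ⟨((hT μ).1 hμ).1.1, ((hT μ).1 hμ).2.1.1⟩
  let ι : T → Fib ⟨ν, hν⟩ := fun μ ↦
    ⟨(⟨(μ : F × F).1, (hmemD μ μ.2).1⟩, ⟨(μ : F × F).2, (hmemD μ μ.2).2⟩), Subtype.ext ((hT μ).1 μ.2).2.2⟩
  have hι : Function.Injective ι := by
    intro μ μ' h
    have h1 := congrArg (fun p : Fib ⟨ν, hν⟩ ↦ ((p.1.1 : F), (p.1.2 : F))) h
    exact Subtype.ext (Prod.ext (congrArg Prod.fst h1) (congrArg Prod.snd h1))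
  have hsupp : Function.support (fun p : Fib ⟨ν, hν⟩ ↦ a p.1.1 * b p.1.2) ⊆ Set.range ι := by
    intro p hp
    rw [Function.mem_support] at hp
    have ha : a p.1.1 ≠ 0 := left_ne_zero_of_mul hp
    have hb : b p.1.2 ≠ 0 := right_ne_zero_of_mul hp
    have h1 : (p.1.1 : F) ∈ qIndexSet F := by
      by_contra h; exact ha (hsf _ p.1.1.2 h)
    have h2 : (p.1.2 : F) ∈ qIndexSet F := by
      by_contra h; exact hb (hsg _ p.1.2.2 h)
    have hsum : (p.1.1 : F) + p.1.2 = ν := congrArg Subtype.val p.2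
    refine ⟨⟨((p.1.1 : F), (p.1.2 : F)), (hT _).2 ⟨h1, h2, hsum⟩⟩, ?_⟩
    apply Subtype.ext
    rfl
  rw [← hι.tsum_eq hsupp, tsum_fintype, Finset.sum_coe_sort T (fun μ ↦ a μ.1 * b μ.2)]

end Summit.Langlands.Langlands.Theorems.HilbertIntegralOverconvergentIsCongruence
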